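import Summits.HubbardSuperconductivity.HubbardSuperconductivity.Theorems.AposterioriCapRgSeededBrokenRegimeBoseFermiPinnedChargeSeedCovariance

/-!
# Crux `SeededBrokenRegimeBoseFermiPinned` (stmt-HubbardSuperconductivity-14047), line `seed-strength-flow`:
# seed parity of the countertermed effective action (stub `stub_seedParity`, S10a)

Support file (`--supports stmt-HubbardSuperconductivity-14047`).  In the seeded free covariance of the Hubbard torus
in the frame `K` the seed `h` enters only the ANOMALOUS Nambu entries `G₀₁ = G₁₀ = hφ_d/(ω² + e_K² + h²φ_d²)`, which are
odd in `h`, while the normal entries `G₀₀, G₁₁` are even (`nambuPropagatorCT_neg_seed`).  In the original field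
labels this reads `C^K_{-h}(X, Y) = w(X) w(Y) C^K_h(X, Y)` with `w(ψ⁺) = -i`, `w(ψ⁻) = i`
(`hubbardCovAboveCT_neg_seed`: reciprocal weights on a normal pair, `(∓i)² = -1` on an anomalous one), i.e. the
rescaled covariance of the charge scaling by `z = i` in `stub_chargeSeedCovariance` (S9).  Hence REVERSING THE SEED
IS THE CHARGE ROTATION BY `π/2`: `𝒢^K_Λ(-h) = S_i 𝒢^K_Λ(h)`, `S_i : ψ⁺ ↦ iψ⁺, ψ⁻ ↦ -iψ⁻` — the in-family instance of
the rotation identity (consequences: `Z^K_Λ` and every charge-`4k` kernel are even in `h`, every charge-`4k+2`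
kernel, in particular the anomalous self-energy, is odd).
-/

set_option linter.dupNamespace false -- `Summit.<S>.<S>` doubles the summit name (tree convention)

namespace Summit.HubbardSuperconductivity.HubbardSuperconductivity.Theorems.AposterioriCapRgSeededBrokenRegimeBoseFermiPinned

open Literature.MathematicalPhysics.QuantumLattice Literature.Probability.LatticeModels GrassmannAlgebra

variable (L M : ℕ)

/-- The BCS denominator is even in the seed. [folklore] -/
theorem nambuDenCT_neg_seed (β μ h : ℝ) (K : TrigPolyC4v) (k : FreqMomentum L M) :
    nambuDenCT L M β μ (-h) K k = nambuDenCT L M β μ h K k := by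
  simp only [nambuDenCT, neg_mul, neg_sq]

/-- **Seed parity of the Nambu propagator**: the normal entries are even, the anomalous entries odd in `h`:
`G_{-h}(k)_{ab} = (if a = b then 1 else -1) · G_h(k)_{ab}`. [folklore] -/
theorem nambuPropagatorCT_neg_seed (β μ h : ℝ) (K : TrigPolyC4v) (k : FreqMomentum L M) (a b : Fin 2) :
    nambuPropagatorCT L M β μ (-h) K k a b = (if a = b then 1 else -1) * nambuPropagatorCT L M β μ h K k a b := by
  fin_cases a <;> fin_cases b <;>
    simp [nambuPropagatorCT, nambuDenCT_neg_seed, neg_div]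

/-- Seed parity of the Nambu two-point table: `⟨Ψ⁻_{k,a}Ψ⁺_{k,b}⟩_{-h} = (if a = b then 1 else -1)⟨Ψ⁻_{k,a}Ψ⁺_{k,b}⟩_h`.
[folklore] -/
theorem nambuTwoPointCT_neg_seed (β μ h : ℝ) (K : TrigPolyC4v) (X Y : (FreqMomentum L M × Fin 2) × Fin 2) :
    nambuTwoPointCT L M β μ (-h) K X Y = (if X.1.2 = Y.1.2 then 1 else -1) * nambuTwoPointCT L M β μ h K X Y := by
  simp only [nambuTwoPointCT]
  split_ifs with h1 h2 h2
  · rw [nambuPropagatorCT_neg_seed, if_pos h2]; ring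
  · rw [nambuPropagatorCT_neg_seed, if_neg h2]; ring
  · ring
  · ring

variable {L M}

/-- **Seed parity of the free two-point table in the original labels**: with the charge weights `w(ψ⁺) = -i`,
`w(ψ⁻) = i`, `⟨ψ_Xψ_Y⟩^K_{-h} = w(X) w(Y) ⟨ψ_Xψ_Y⟩^K_h` (reciprocal weights on a normal pair, `-1` on an anomalous
pair; checked through the Nambu relabelling case by case). [folklore] -/
theorem hubbardTwoPointCT_neg_seed [NeZero L] (β μ h : ℝ) (K : TrigPolyC4v) (X Y : HubbardFieldIdx L M) :
    hubbardTwoPointCT L M β μ (-h) K X Y =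
      (if X.2 = 0 then -Complex.I else Complex.I) * (if Y.2 = 0 then -Complex.I else Complex.I) *
        hubbardTwoPointCT L M β μ h K X Y := by
  obtain ⟨⟨k, σ⟩, q⟩ := X
  obtain ⟨⟨k', σ'⟩, q'⟩ := Y
  simp only [hubbardTwoPointCT, nambuTwoPointCT_neg_seed]
  fin_cases σ <;> fin_cases q <;> fin_cases σ' <;> fin_cases q' <;>
    simp [toNambu, nambuTwoPointCT, Fin.rev]

/-- **Seed parity of the covariance above scale `Λ`** (the cutoff weight does not see the seed):
`C^{K,>Λ}_{-h}(X, Y) = w(X) w(Y) C^{K,>Λ}_h(X, Y)`, `w(ψ⁺) = -i`, `w(ψ⁻) = i`. [folklore] -/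
theorem hubbardCovAboveCT_neg_seed [NeZero L] (β μ h : ℝ) (K : TrigPolyC4v) (Λ : ℝ) (X Y : HubbardFieldIdx L M) :
    hubbardCovAboveCT L M β μ (-h) K Λ X Y =
      (if X.2 = 0 then -Complex.I else Complex.I) * (if Y.2 = 0 then -Complex.I else Complex.I) *
        hubbardCovAboveCT L M β μ h K Λ X Y := by
  simp only [hubbardCovAboveCT, hubbardCovarianceCT, Matrix.of_apply, hubbardTwoPointCT_neg_seed]
  ring

/-- **S10a (`SeedParity`)**: reversing the Koma–Tasaki seed is the charge rotation by `π/2` of the fields,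
`𝒢^K_Λ(-h) = S_i 𝒢^K_Λ(h)` with `S_i : ψ⁺ ↦ iψ⁺, ψ⁻ ↦ -iψ⁻`, for every `L ≥ 1`, `M`, `β`, `U`, `μ`, frame `K` and
scale `Λ` — the in-family instance `z = i` of the `U(1)` × seed covariance S9 (the rescaled covariance of S9 at
`z = i` is the covariance at seed `-h`, `hubbardCovAboveCT_neg_seed`). [folklore] -/
theorem stub_seedParity :
    ∀ (L M : ℕ) [NeZero L] (β U μ h : ℝ) (K : TrigPolyC4v) (Λ : ℝ),
      hubbardEffectiveActionCT L M β U μ (-h) K Λ =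
        ExteriorAlgebra.map
          (LinearMap.mulLeft ℂ (fun X : HubbardFieldIdx L M => if X.2 = 0 then Complex.I else -Complex.I))
          (hubbardEffectiveActionCT L M β U μ h K Λ) := by
  intro L M _ β U μ h K Λ
  have hS := stub_chargeSeedCovariance L M β U μ h K Λ Complex.I Complex.I_ne_zero
  rw [Complex.inv_I] at hS
  rw [hS, hubbardEffectiveActionCT_def]
  congr 1
  ext X Y
  rw [Matrix.of_apply, hubbardCovAboveCT_neg_seed]

end Summit.HubbardSuperconductivity.HubbardSuperconductivity.Theorems.AposterioriCapRgSeededBrokenRegimeBoseFermiPinned
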